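import Mathlib
import Summits.Ventures.PercRepro2.StarHCells

/-!
# The hub class `{a₁, a₂, o, b}`: the natural events of the table as unions of cells (blind cell
PercRepro2, night-1 g12; NIGHT1-G12.md)

`Q ∩ {o ∈ C₁} = LL ∪ LH ∪ LN`, `Q = ⋃ the ten cells`, `Q ∩ {o ∈ C₁} ∩ {b ∈ C₁} = LL`, … — the set
identities behind the atoms of `HMF_star_h` (StarHClass); each by `ext`, the transitivity facts of the
connection relation and `tauto`.
-/

namespace Summit.Ventures.PercRepro2

open StarGlue PendantRoot

namespace StarH

section CellSets

variable {V : Type*} {E : Type*}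

variable (ends : E → Sym2 V) (a₁ a₂ o b : V)

/-- `Q ∩ {o ∈ C₁} ∩ {b ∈ C₁}` is the cell `LL`. -/
lemma cLL_eq :
    avoidAll ends a₂ {a₁} ∩ connEvent ends a₁ o ∩ connEvent ends a₁ b = cLL ends a₁ a₂ o b := by
  ext ω
  have t1 : Conn ends ω a₁ o → Conn ends ω a₂ o → Conn ends ω a₁ a₂ := fun h h' => conn_trans h (conn_symm h')
  have t4 : Conn ends ω a₁ b → Conn ends ω a₂ b → Conn ends ω a₁ a₂ := fun h h' => conn_trans h (conn_symm h')
  have t7 : Conn ends ω a₁ o → Conn ends ω a₁ b → Conn ends ω o b := fun h h' => conn_trans (conn_symm h) h'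
  simp only [cLL, Set.mem_inter_iff, Set.mem_compl_iff, mem_connEvent, avoidAll_eq_compl]
  tauto

/-- `Q ∩ {o ∈ C₂} ∩ {b ∈ C₂}` is the cell `HH`. -/
lemma cHH_eq :
    avoidAll ends a₂ {a₁} ∩ connEvent ends a₂ o ∩ connEvent ends a₂ b = cHH ends a₁ a₂ o b := by
  ext ω
  have t1 : Conn ends ω a₁ o → Conn ends ω a₂ o → Conn ends ω a₁ a₂ := fun h h' => conn_trans h (conn_symm h')
  have t4 : Conn ends ω a₁ b → Conn ends ω a₂ b → Conn ends ω a₁ a₂ := fun h h' => conn_trans h (conn_symm h')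
  have t10 : Conn ends ω a₂ o → Conn ends ω a₂ b → Conn ends ω o b := fun h h' => conn_trans (conn_symm h) h'
  simp only [cHH, Set.mem_inter_iff, Set.mem_compl_iff, mem_connEvent, avoidAll_eq_compl]
  tauto

/-- The event of `Eprod'_le` for `(o, a₁, a₂, b)` is the cell `LL`. -/
lemma cLL_eq' :
    connEvent ends a₁ o ∩ connEvent ends a₁ b ∩ (connEvent ends a₂ a₁)ᶜ = cLL ends a₁ a₂ o b := by
  ext ω
  have t1 : Conn ends ω a₁ o → Conn ends ω a₂ o → Conn ends ω a₁ a₂ := fun h h' => conn_trans h (conn_symm h')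
  have t4 : Conn ends ω a₁ b → Conn ends ω a₂ b → Conn ends ω a₁ a₂ := fun h h' => conn_trans h (conn_symm h')
  have t7 : Conn ends ω a₁ o → Conn ends ω a₁ b → Conn ends ω o b := fun h h' => conn_trans (conn_symm h) h'
  have s12 : Conn ends ω a₁ a₂ → Conn ends ω a₂ a₁ := fun h => conn_symm h
  have s21 : Conn ends ω a₂ a₁ → Conn ends ω a₁ a₂ := fun h => conn_symm h
  simp only [cLL, Set.mem_inter_iff, Set.mem_compl_iff, mem_connEvent, avoidAll_eq_compl]
  tauto

/-- The event of `Eprod'_le` for `(o, a₂, a₁, b)` is the cell `HH`. -/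
lemma cHH_eq' :
    connEvent ends a₂ o ∩ connEvent ends a₂ b ∩ (connEvent ends a₁ a₂)ᶜ = cHH ends a₁ a₂ o b := by
  ext ω
  have t1 : Conn ends ω a₁ o → Conn ends ω a₂ o → Conn ends ω a₁ a₂ := fun h h' => conn_trans h (conn_symm h')
  have t4 : Conn ends ω a₁ b → Conn ends ω a₂ b → Conn ends ω a₁ a₂ := fun h h' => conn_trans h (conn_symm h')
  have t10 : Conn ends ω a₂ o → Conn ends ω a₂ b → Conn ends ω o b := fun h h' => conn_trans (conn_symm h) h'
  have s12 : Conn ends ω a₁ a₂ → Conn ends ω a₂ a₁ := fun h => conn_symm h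
  have s21 : Conn ends ω a₂ a₁ → Conn ends ω a₁ a₂ := fun h => conn_symm h
  simp only [cHH, Set.mem_inter_iff, Set.mem_compl_iff, mem_connEvent, avoidAll_eq_compl]
  tauto

/-- `Q ∩ {o ∈ C₁} ∩ {b ∉ U}` is the cell `LN`. -/
lemma cLN_eq :
    avoidAll ends a₂ {a₁} ∩ connEvent ends a₁ o ∩ (connEvent ends a₁ b)ᶜ ∩ (connEvent ends a₂ b)ᶜ =
      cLN ends a₁ a₂ o b := by
  ext ω
  have t1 : Conn ends ω a₁ o → Conn ends ω a₂ o → Conn ends ω a₁ a₂ := fun h h' => conn_trans h (conn_symm h')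
  have t8 : Conn ends ω a₁ o → Conn ends ω o b → Conn ends ω a₁ b := fun h h' => conn_trans h h'
  simp only [cLN, Set.mem_inter_iff, Set.mem_compl_iff, mem_connEvent, avoidAll_eq_compl]
  tauto

/-- `Q ∩ {o ∈ C₂} ∩ {b ∉ U}` is the cell `HN`. -/
lemma cHN_eq :
    avoidAll ends a₂ {a₁} ∩ connEvent ends a₂ o ∩ (connEvent ends a₁ b)ᶜ ∩ (connEvent ends a₂ b)ᶜ =
      cHN ends a₁ a₂ o b := by
  ext ω
  have t1 : Conn ends ω a₁ o → Conn ends ω a₂ o → Conn ends ω a₁ a₂ := fun h h' => conn_trans h (conn_symm h')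
  have t11 : Conn ends ω a₂ o → Conn ends ω o b → Conn ends ω a₂ b := fun h h' => conn_trans h h'
  simp only [cHN, Set.mem_inter_iff, Set.mem_compl_iff, mem_connEvent, avoidAll_eq_compl]
  tauto

/-- `Q ∩ {o ∈ C₁}` is the union of the cells `LL, LH, LN`. -/
lemma Q_oL_eq :
    avoidAll ends a₂ {a₁} ∩ connEvent ends a₁ o =
      cLL ends a₁ a₂ o b ∪ cLH ends a₁ a₂ o b ∪ cLN ends a₁ a₂ o b := by
  ext ω
  have t1 : Conn ends ω a₁ o → Conn ends ω a₂ o → Conn ends ω a₁ a₂ := fun h h' => conn_trans h (conn_symm h')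
  have t4 : Conn ends ω a₁ b → Conn ends ω a₂ b → Conn ends ω a₁ a₂ := fun h h' => conn_trans h (conn_symm h')
  have t7 : Conn ends ω a₁ o → Conn ends ω a₁ b → Conn ends ω o b := fun h h' => conn_trans (conn_symm h) h'
  have t8 : Conn ends ω a₁ o → Conn ends ω o b → Conn ends ω a₁ b := fun h h' => conn_trans h h'
  simp only [cLL, cLH, cLN, Set.mem_union, Set.mem_inter_iff, Set.mem_compl_iff, mem_connEvent,
    avoidAll_eq_compl]
  tauto

/-- `Q ∩ {o ∈ C₂}` is the union of the cells `HL, HH, HN`. -/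
lemma Q_oH_eq :
    avoidAll ends a₂ {a₁} ∩ connEvent ends a₂ o =
      cHL ends a₁ a₂ o b ∪ cHH ends a₁ a₂ o b ∪ cHN ends a₁ a₂ o b := by
  ext ω
  have t1 : Conn ends ω a₁ o → Conn ends ω a₂ o → Conn ends ω a₁ a₂ := fun h h' => conn_trans h (conn_symm h')
  have t4 : Conn ends ω a₁ b → Conn ends ω a₂ b → Conn ends ω a₁ a₂ := fun h h' => conn_trans h (conn_symm h')
  have t10 : Conn ends ω a₂ o → Conn ends ω a₂ b → Conn ends ω o b := fun h h' => conn_trans (conn_symm h) h'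
  have t11 : Conn ends ω a₂ o → Conn ends ω o b → Conn ends ω a₂ b := fun h h' => conn_trans h h'
  simp only [cHL, cHH, cHN, Set.mem_union, Set.mem_inter_iff, Set.mem_compl_iff, mem_connEvent,
    avoidAll_eq_compl]
  tauto

/-- `Q ∩ {b ∈ C₁}` is the union of the cells `LL, HL, NL`. -/
lemma Q_bL_eq :
    avoidAll ends a₂ {a₁} ∩ connEvent ends a₁ b =
      cLL ends a₁ a₂ o b ∪ cHL ends a₁ a₂ o b ∪ cNL ends a₁ a₂ o b := by
  ext ω
  have t1 : Conn ends ω a₁ o → Conn ends ω a₂ o → Conn ends ω a₁ a₂ := fun h h' => conn_trans h (conn_symm h')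
  have t4 : Conn ends ω a₁ b → Conn ends ω a₂ b → Conn ends ω a₁ a₂ := fun h h' => conn_trans h (conn_symm h')
  have t7 : Conn ends ω a₁ o → Conn ends ω a₁ b → Conn ends ω o b := fun h h' => conn_trans (conn_symm h) h'
  have t9 : Conn ends ω a₁ b → Conn ends ω o b → Conn ends ω a₁ o := fun h h' => conn_trans h (conn_symm h')
  simp only [cLL, cHL, cNL, Set.mem_union, Set.mem_inter_iff, Set.mem_compl_iff, mem_connEvent,
    avoidAll_eq_compl]
  tauto

/-- `Q ∩ {b ∈ C₂}` is the union of the cells `LH, HH, NH`. -/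
lemma Q_bH_eq :
    avoidAll ends a₂ {a₁} ∩ connEvent ends a₂ b =
      cLH ends a₁ a₂ o b ∪ cHH ends a₁ a₂ o b ∪ cNH ends a₁ a₂ o b := by
  ext ω
  have t1 : Conn ends ω a₁ o → Conn ends ω a₂ o → Conn ends ω a₁ a₂ := fun h h' => conn_trans h (conn_symm h')
  have t4 : Conn ends ω a₁ b → Conn ends ω a₂ b → Conn ends ω a₁ a₂ := fun h h' => conn_trans h (conn_symm h')
  have t10 : Conn ends ω a₂ o → Conn ends ω a₂ b → Conn ends ω o b := fun h h' => conn_trans (conn_symm h) h'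
  have t12 : Conn ends ω a₂ b → Conn ends ω o b → Conn ends ω a₂ o := fun h h' => conn_trans h (conn_symm h')
  simp only [cLH, cHH, cNH, Set.mem_union, Set.mem_inter_iff, Set.mem_compl_iff, mem_connEvent,
    avoidAll_eq_compl]
  tauto

/-- `Q` is the union of the ten cells. -/
lemma Q_eq :
    avoidAll ends a₂ {a₁} =
      cLL ends a₁ a₂ o b ∪ cLH ends a₁ a₂ o b ∪ cLN ends a₁ a₂ o b ∪ cHL ends a₁ a₂ o b ∪
        cHH ends a₁ a₂ o b ∪ cHN ends a₁ a₂ o b ∪ cNL ends a₁ a₂ o b ∪ cNH ends a₁ a₂ o b ∪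
        cNNt ends a₁ a₂ o b ∪ cNNs ends a₁ a₂ o b := by
  ext ω
  have h := cell_partition ends a₁ a₂ o b (ω := ω)
  simp only [Set.mem_union, or_assoc]
  exact h

/-- `Q ∩ {b ∉ U}` is the union of the cells `LN, HN, NNt, NNs`. -/
lemma Q_bN_eq :
    avoidAll ends a₂ {a₁} ∩ (connEvent ends a₁ b)ᶜ ∩ (connEvent ends a₂ b)ᶜ =
      cLN ends a₁ a₂ o b ∪ cHN ends a₁ a₂ o b ∪ cNNt ends a₁ a₂ o b ∪ cNNs ends a₁ a₂ o b := by
  ext ω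
  have t1 : Conn ends ω a₁ o → Conn ends ω a₂ o → Conn ends ω a₁ a₂ := fun h h' => conn_trans h (conn_symm h')
  have t8 : Conn ends ω a₁ o → Conn ends ω o b → Conn ends ω a₁ b := fun h h' => conn_trans h h'
  have t11 : Conn ends ω a₂ o → Conn ends ω o b → Conn ends ω a₂ b := fun h h' => conn_trans h h'
  simp only [cLN, cHN, cNNt, cNNs, Set.mem_union, Set.mem_inter_iff, Set.mem_compl_iff, mem_connEvent,
    avoidAll_eq_compl]
  tauto

end CellSets

end StarH

end Summit.Ventures.PercRepro2
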